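import Summits.Ventures.PackingBounds.ThreePointCert.C4FProof
import Summits.Ventures.PackingBounds.Configurations.PetersenCode

/-!
# `A(4, arccos s) = 10` for `1/6 ≤ s ≤ 1/5` (two-sided, kernel-checked)

Framing: lottery ticket; floor = certified bounds/negative ranges. Venture `PackingBounds`
(cell `pub-packcert`), spherical-codes family, cell B2c `(4, 1/5)`.

Upper side: the kernel-checked Bachoc–Vallentin three-point certificate
`ThreePointCert.C4F.code_dim4_fifth_le_10_sdp` (`n = 4`, `s = 1/5`, degree 10, Bachoc–Vallentin's
multiplier set; exact bound value `10.761342 < 11`). Lower side: the Petersen code / rectified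
4-simplex (`Config.PetersenCode.exists_code_10_of_le`: ten unit vectors of `ℝ⁴` with pairwise inner
products `≤ 1/6`). Together: the largest size of a spherical code in `S³` with minimal angle
`≥ arccos s` is exactly `10` for every `s ∈ [1/6, 1/5]` (Bachoc–Vallentin 2009 proved the case
`s = 1/6` with uniqueness); in Tammes form, among any `11` unit vectors of `ℝ⁴` two distinct ones make
an angle `< arccos(1/5) = 78.463…°` (the printed bound for the 11-point problem on `S³` is
Pfender 2007, Table 2: `78.73°`; best configuration known `76.67°`).

## References
* C. Bachoc, F. Vallentin, J. Amer. Math. Soc. 21 (2008), Theorem 4.2. [`BachocVallentin2007`]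
* C. Bachoc, F. Vallentin, Optimality and uniqueness of the (4,10,1/6) spherical code,
  J. Combin. Theory Ser. A 116 (2009) 195–204.
* F. Pfender, J. Combin. Theory Ser. A 114 (2007) 1133–1147, Table 2.
-/

noncomputable section

open Finset
open scoped RealInnerProductSpace

namespace Summit.Ventures.PackingBounds.SphericalCodes

/-- **`A(4, arccos s) = 10` on `[1/6, 1/5]`** (two-sided, kernel-checked): for `1/6 ≤ s ≤ 1/5` there
is a 10-point code of unit vectors of `ℝ⁴` with pairwise inner products `≤ s` (Petersen code), and
every such code has at most `10` points (three-point SDP certificate at `s = 1/5`). -/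
theorem code_dim4_eq_10_of_mem_Icc {s : ℝ} (hs : (1 / 6 : ℝ) ≤ s) (hs' : s ≤ 1 / 5) :
    (∃ C : Finset (EuclideanSpace ℝ (Fin 4)), C.card = 10 ∧ (∀ x ∈ C, ‖x‖ = 1) ∧
      (∀ x ∈ C, ∀ y ∈ C, x ≠ y → inner ℝ x y ≤ s)) ∧
    ∀ C : Finset (EuclideanSpace ℝ (Fin 4)), (∀ x ∈ C, ‖x‖ = 1) →
      (∀ x ∈ C, ∀ y ∈ C, x ≠ y → inner ℝ x y ≤ s) → C.card ≤ 10 :=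
  ⟨Config.PetersenCode.exists_code_10_of_le hs, fun C h1 h2 =>
    ThreePointCert.C4F.code_dim4_fifth_le_10_sdp C h1
      (fun x hx y hy hxy => (h2 x hx y hy hxy).trans hs')⟩

/-- **Tammes form** (the 11-point problem on `S³`): among any `11` unit vectors of `ℝ⁴`, two distinct
ones have inner product `> 1/5`, i.e. make an angle `< arccos(1/5) = 78.463…°` (printed bound:
`78.73°`, Pfender 2007, Table 2). -/
theorem exists_inner_gt_fifth_of_card_eq_11 (C : Finset (EuclideanSpace ℝ (Fin 4)))
    (h1 : ∀ x ∈ C, ‖x‖ = 1) (hC : C.card = 11) :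
    ∃ x ∈ C, ∃ y ∈ C, x ≠ y ∧ (1 / 5 : ℝ) < inner ℝ x y := by
  by_contra h
  push Not at h
  have h10 := ThreePointCert.C4F.code_dim4_fifth_le_10_sdp C h1 (fun x hx y hy hxy => h x hx y hy hxy)
  omega

end Summit.Ventures.PackingBounds.SphericalCodes

end
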